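import Summits.AtomisticToContinuum.BoseEinsteinCondensation.Theorems.SoloInformedOccupationSeminorm
import Literature.MathematicalPhysics.QuantumManyBody.BoseGasTrialStateCompactness

/-!
# The condensate number of the conjunct IS `λ_max(γ_{Ψ₀})` of the nondegenerate ground state

Conjunct `BoseEinsteinCondensation` of `AtomisticToContinuum` — statement audit, part 2 of the
ground-state door (soloist report `paper/sharpest.md` §1, §7). With part 1
(`SoloInformedOccupationSeminorm.lean`: `condensateNumber ≤ λ_max(γ_Ψ)` for every ground state,
`λ_max^{1/2}` is `√N`-Lipschitz in `L²`) this file proves that the audited minimising-sequence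
definition of the condensate number is faithful to the literature's notion
[LSSY2005, §1.2 (1.17)–(1.19)]:

* `SoloInformed.exists_slack_sq_dist_groundState_le` — **near-minimisers converge to the ground
  state**: if the ground state of `N` bosons in `Λ_L` is nondegenerate (`HasUniqueGroundState`;
  Reed–Simon IV Thm XIII.47 for finite `v`), then for every `ε > 0` there is a slack `δ > 0` such
  that every Dirichlet trial state with `⟨Ψ, H_N Ψ⟩ ≤ E₀ + δ` is within `ε` of `Ψ₀ = groundState v N L`
  in `L²` modulo a constant phase. Compactness proof: Rellich for trial states with bounded kinetic
  energy (`BoxFace.exists_subseq_tendsto_of_trialStates`, [Evans2010, §5.7 Thm 1]), lower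
  semicontinuity built into the closed form (`IsGroundState.of_tendstoL2`, Kato VI Thm 1.16),
  symmetrisation and Dirichlet cut-off of the limit, uniqueness;
* `SoloInformed.maxOccupation_groundState_le_condensateNumber`,
  `SoloInformed.condensateNumber_eq_maxOccupation_groundState` — under nondegeneracy
  **`condensateNumber v N L = λ_max(γ_{Ψ₀})`**;
* the doors `SoloInformed.hasGroundStateBEC_of_groundState_maxOccupation` /
  `…_of_groundState_occupation` (eventual nondegeneracy of the ground states of the boxes
  `Λ_{(N/ρ)^{1/3}}` plus `⟨φ_N, γ_{Ψ₀} φ_N⟩ ≥ cN` for some normalised modes gives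
  `HasGroundStateBEC v ρ`) and `SoloInformed.boseEinsteinCondensation_of_groundState_maxOccupation`
  (the conjunct). Through these doors any argument about the nonnegative ground state `Ψ₀` itself —
  Bogoliubov theory, or the point-process / relative-entropy criteria for `|Ψ₀|²` of the soloist
  report — enters the audited statement; the converse direction
  (`SoloInformed.eventually_le_maxOccupation_of_hasGroundStateBEC`, part 1) is unconditional.

References: [LSSY2005] Lieb–Seiringer–Solovej–Yngvason, *The Mathematics of the Bose Gas and its
Condensation* (2005), §1.2 (1.17)–(1.19); [ReedSimonIV1978] Reed–Simon, *Methods of Modern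
Mathematical Physics IV* (1978), §XIII.12 Thms XIII.46–47; [Evans2010] Evans, *Partial Differential
Equations*, 2nd ed., §5.7 Thm 1; [Kato1966] Kato, *Perturbation Theory*, VI §1.3–1.4, Thm 1.16.
-/

noncomputable section

open MeasureTheory Filter Set
open scoped ENNReal NNReal ComplexConjugate Topology

namespace Summit.AtomisticToContinuum.BoseEinsteinCondensation.Theorems

open Literature.MathematicalPhysics.QuantumManyBody.BoseGas

variable {n : ℕ}

/-- **Near-minimisers converge to the nondegenerate ground state.** If the ground state of `N`
bosons in `Λ_L` is nondegenerate (`HasUniqueGroundState`), then for every `ε > 0` there is a slack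
`δ > 0` such that every Dirichlet trial state with `⟨Ψ, H_N Ψ⟩ ≤ E₀ + δ` satisfies
`∫ |Ψ - c Ψ₀|² ≤ ε` for some constant phase `c`, `Ψ₀ = groundState v N L`. Proof by compactness:
a sequence of near-minimisers violating this has bounded kinetic energy, hence (Rellich, Evans
§5.7 Thm 1) an `L²`- and a.e.-convergent subsequence; the (symmetrised, Dirichlet-cut)
limit is a ground state by lower semicontinuity of the closed form (Kato VI Thm 1.16), hence a
phase multiple of `Ψ₀` by nondegeneracy (Reed–Simon IV Thm XIII.47) — contradiction.
[cite: ReedSimonIV1978, §XIII.12 Thms XIII.46–XIII.47] -/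
theorem SoloInformed.exists_slack_sq_dist_groundState_le {N : ℕ} {v : ℝ → ℝ≥0∞} {L : ℝ}
    (hL : 0 ≤ L) (hU : HasUniqueGroundState v N L) {ε : ℝ≥0∞} (hε : 0 < ε) :
    ∃ δ : ℝ≥0∞, 0 < δ ∧ ∀ Ψ : TrialState N L,
      energy v Ψ ≤ groundStateEnergy v N L + δ →
        ∃ c : ℂ, ‖c‖ = 1 ∧
          ∫⁻ X, (‖Ψ.ψ X - c * (groundState v N L X : ℂ)‖₊ : ℝ≥0∞) ^ 2 ≤ ε := by
  by_contra hcon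
  push Not at hcon
  have hGS : IsGroundState v L (fun X => (groundState v N L X : ℂ)) :=
    hU.isGroundState_groundState
  have hE : groundStateEnergy v N L ≠ ⊤ := hGS.groundStateEnergy_ne_top
  have hδpos : ∀ m : ℕ, (0 : ℝ≥0∞) < ((m + 1 : ℕ) : ℝ≥0∞)⁻¹ := fun m =>
    ENNReal.inv_pos.2 (ENNReal.natCast_ne_top _)
  choose Φ hΦE hΦfar using fun m : ℕ => hcon _ (hδpos m)
  -- uniform kinetic bound `≤ E₀ + 1`
  have hK : groundStateEnergy v N L + 1 ≠ ⊤ := ENNReal.add_ne_top.2 ⟨hE, ENNReal.one_ne_top⟩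
  have hkin : ∀ m, ∫⁻ X, kineticDensity (Φ m).ψ X ≤ groundStateEnergy v N L + 1 := by
    intro m
    calc ∫⁻ X, kineticDensity (Φ m).ψ X ≤ energy v (Φ m) := by
          unfold energy
          exact lintegral_mono fun X => le_self_add
      _ ≤ groundStateEnergy v N L + ((m + 1 : ℕ) : ℝ≥0∞)⁻¹ := hΦE m
      _ ≤ groundStateEnergy v N L + 1 := by
          gcongr
          exact ENNReal.inv_le_one.2 (Nat.one_le_cast.2 (Nat.le_add_left 1 m))
  -- Rellich: an `L²`- and a.e.-convergent subsequence
  obtain ⟨f, κ, hκ, hf2, hlim, hae⟩ :=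
    BoxFace.exists_subseq_tendsto_of_trialStates (N := N) (fun _ => L) (Lbar := L)
      (fun _ => hL) (fun _ => le_rfl) Φ hK hkin
  -- (1) a measurable version of the limit
  set f₁ : Config N → ℂ := hf2.1.mk f with hf₁
  have hf₁m : Measurable f₁ := hf2.1.stronglyMeasurable_mk.measurable
  have hff₁ : f =ᵐ[volume] f₁ := hf2.1.ae_eq_mk
  -- (2) Dirichlet cut-off: the limit vanishes a.e. off the box anyway
  set f₂ : Config N → ℂ := (boxN N L).indicator f₁ with hf₂
  have hf₂m : Measurable f₂ := hf₁m.indicator (SoloInformed.measurableSet_boxN N L)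
  have hf0 : ∀ᵐ X : Config N, X ∉ boxN N L → f X = 0 := by
    filter_upwards [hae] with X hX hXb
    have h0 : (fun m => (Φ (κ m)).ψ X) = fun _ => 0 := funext fun m => (Φ (κ m)).eq_zero X hXb
    rw [h0] at hX
    exact tendsto_nhds_unique hX tendsto_const_nhds
  have hff₂ : f =ᵐ[volume] f₂ := by
    filter_upwards [hff₁, hf0] with X h1 h0
    by_cases hX : X ∈ boxN N L
    · rw [hf₂, Set.indicator_of_mem hX]
      exact h1
    · rw [hf₂, Set.indicator_of_notMem hX]
      exact h0 hX
  -- (3) symmetrisation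
  set g : Config N → ℂ := fun X => ((Fintype.card (Equiv.Perm (Fin N)) : ℂ))⁻¹ *
      ∑ σ : Equiv.Perm (Fin N), f₂ (X ∘ σ) with hg
  have hgm : Measurable g :=
    measurable_const.mul (Finset.measurable_sum _ fun σ _ =>
      hf₂m.comp (SoloInformed.measurable_comp_perm σ))
  have hg0 : ∀ X, X ∉ boxN N L → g X = 0 := by
    intro X hX
    have h0 : ∀ σ : Equiv.Perm (Fin N), f₂ (X ∘ σ) = 0 := fun σ => by
      rw [hf₂]
      exact Set.indicator_of_notMem
        (fun h => hX ((SoloInformed.comp_perm_mem_boxN_iff σ L X).1 h)) _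
    simp only [hg, h0, Finset.sum_const_zero, mul_zero]
  have hgs : ∀ (τ : Equiv.Perm (Fin N)) (X : Config N), g (X ∘ τ) = g X := by
    intro τ X
    simp only [hg]
    congr 1
    exact Fintype.sum_equiv (Equiv.mulLeft τ) _ _ fun σ => rfl
  -- (4) the symmetrised cut-off version agrees with the limit a.e.
  have hT : ∀ σ : Equiv.Perm (Fin N),
      MeasurePreserving (fun X : Config N => X ∘ σ) volume volume :=
    fun σ => SoloInformed.measurePreserving_comp_perm σ
  have hfσ : ∀ σ : Equiv.Perm (Fin N), (fun X => f (X ∘ σ)) =ᵐ[volume] f := by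
    intro σ
    have h1 := (hT σ).quasiMeasurePreserving.ae hae
    filter_upwards [h1, hae] with X hXσ hX
    have e : (fun m => (Φ (κ m)).ψ (X ∘ σ)) = fun m => (Φ (κ m)).ψ X :=
      funext fun m => (Φ (κ m)).symm σ X
    have hXσ' : Tendsto (fun m => (Φ (κ m)).ψ X) atTop (𝓝 (f (X ∘ σ))) := by
      rw [← e]
      exact hXσ
    exact tendsto_nhds_unique hXσ' hX
  have hf₂σ : ∀ σ : Equiv.Perm (Fin N), (fun X => f₂ (X ∘ σ)) =ᵐ[volume] f₂ := by
    intro σ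
    have h1 : (fun X => f₂ (X ∘ σ)) =ᵐ[volume] fun X => f (X ∘ σ) :=
      (hT σ).quasiMeasurePreserving.ae_eq hff₂.symm
    exact (h1.trans (hfσ σ)).trans hff₂
  have hgf : g =ᵐ[volume] f := by
    have hall : ∀ᵐ X : Config N, ∀ σ : Equiv.Perm (Fin N), f₂ (X ∘ σ) = f₂ X :=
      ae_all_iff.2 fun σ => hf₂σ σ
    filter_upwards [hall, hff₂] with X hX hX2
    simp only [hg, hX, Finset.sum_const, Finset.card_univ, nsmul_eq_mul]
    rw [← mul_assoc, inv_mul_cancel₀ (Nat.cast_ne_zero.2 Fintype.card_ne_zero), one_mul, hX2]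
  -- (5) `L²` convergence of the subsequence to `g`
  have hT2 : Tendsto (fun m => ∫⁻ X, (‖(Φ (κ m)).ψ X - g X‖₊ : ℝ≥0∞) ^ 2) atTop (𝓝 0) := by
    have h1 : ∀ m, ∫⁻ X, (‖(Φ (κ m)).ψ X - g X‖₊ : ℝ≥0∞) ^ 2 =
        (eLpNorm ((Φ (κ m)).ψ - f) 2 volume) ^ 2 := by
      intro m
      rw [eLpNorm_two_eq_rpow, ENNReal.rpow_half_sq]
      refine lintegral_congr_ae (hgf.mono fun X hX => ?_)
      simp only [Pi.sub_apply, hX]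
    simp_rw [h1]
    have := ((ENNReal.continuous_pow 2).tendsto (0 : ℝ≥0∞)).comp hlim
    rwa [zero_pow two_ne_zero] at this
  have hT2' : TendstoL2 (fun m => Φ (κ m)) g := hT2
  -- (6) the energies along the subsequence have `liminf ≤ E₀`
  have hδlim : Tendsto (fun m => ((κ m + 1 : ℕ) : ℝ≥0∞)⁻¹) atTop (𝓝 0) :=
    ENNReal.tendsto_inv_nat_nhds_zero.comp ((tendsto_add_atTop_nat 1).comp hκ.tendsto_atTop)
  have hEn : liminf (fun m => energy v (Φ (κ m))) atTop ≤ groundStateEnergy v N L := by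
    have hup : Tendsto (fun m => groundStateEnergy v N L + ((κ m + 1 : ℕ) : ℝ≥0∞)⁻¹) atTop
        (𝓝 (groundStateEnergy v N L)) := by
      have := (tendsto_const_nhds (x := groundStateEnergy v N L)).add hδlim
      rwa [add_zero] at this
    calc liminf (fun m => energy v (Φ (κ m))) atTop
        ≤ liminf (fun m => groundStateEnergy v N L + ((κ m + 1 : ℕ) : ℝ≥0∞)⁻¹) atTop :=
          liminf_le_liminf (Eventually.of_forall fun m => hΦE (κ m))
      _ = groundStateEnergy v N L := hup.liminf_eq
  -- (7) `g` is a ground state, hence a phase multiple of `Ψ₀`: contradiction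
  have hg_gs : IsGroundState v L g := IsGroundState.of_tendstoL2 hgm hg0 hgs hE hT2' hEn
  obtain ⟨c, hc, hcae⟩ := hU.2 _ g hGS hg_gs
  have hdist : Tendsto
      (fun m => ∫⁻ X, (‖(Φ (κ m)).ψ X - c * (groundState v N L X : ℂ)‖₊ : ℝ≥0∞) ^ 2)
      atTop (𝓝 0) := by
    refine hT2.congr fun m => lintegral_congr_ae (hcae.mono fun X hX => ?_)
    simp only [hX]
  obtain ⟨m, hm⟩ := (hdist.eventually (ge_mem_nhds hε)).exists
  exact absurd hm (not_le.2 (hΦfar (κ m) c hc))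

/-- **`λ_max(γ_{Ψ₀}) ≤ condensateNumber` under nondegeneracy**: every `δ`-near-minimiser is
`L²`-close to `Ψ₀` modulo a phase (`SoloInformed.exists_slack_sq_dist_groundState_le`), `λ_max` is
phase invariant and `L²`-continuous, so `(λ_max(γ_{Ψ₀})^{1/2} - (Nε)^{1/2})² ≤ condensateNumber`
for every `ε > 0`. [cite: LSSY2005, §1.2 (1.17)–(1.19)] -/
theorem SoloInformed.maxOccupation_groundState_le_condensateNumber {v : ℝ → ℝ≥0∞} {L : ℝ}
    (hL : 0 ≤ L) (hU : HasUniqueGroundState v (n + 1) L) :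
    maxOccupation (n + 1) (fun X => (groundState v (n + 1) L X : ℂ)) ≤
      condensateNumber v (n + 1) L := by
  have hGS : IsGroundState v L (fun X => (groundState v (n + 1) L X : ℂ)) :=
    hU.isGroundState_groundState
  have hΨ₀m : Measurable fun X => (groundState v (n + 1) L X : ℂ) := hGS.measurable
  have hΨ₀1 : ∫⁻ X, (‖(groundState v (n + 1) L X : ℂ)‖₊ : ℝ≥0∞) ^ 2 = 1 := hGS.norm_eq
  have hN : (n + 1 : ℝ≥0∞) ≠ ⊤ := ENNReal.add_ne_top.2 ⟨ENNReal.natCast_ne_top n, ENNReal.one_ne_top⟩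
  set A := maxOccupation (n + 1) (fun X => (groundState v (n + 1) L X : ℂ)) with hA
  have hAtop : A ≠ ⊤ := by
    refine ne_top_of_le_ne_top ?_ (SoloInformed.maxOccupation_le hΨ₀m)
    rw [hΨ₀1, mul_one]
    exact hN
  have hhalf : (0 : ℝ) ≤ 1 / 2 := by norm_num
  -- for every `ε > 0`
  have key : ∀ ε : ℝ≥0∞, 0 < ε →
      (A ^ (1 / 2 : ℝ) - ((n + 1 : ℝ≥0∞) * ε) ^ (1 / 2 : ℝ)) ^ 2 ≤
        condensateNumber v (n + 1) L := by
    intro ε hε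
    obtain ⟨δ, hδ, hnear⟩ := SoloInformed.exists_slack_sq_dist_groundState_le hL hU hε
    refine le_condensateNumber v hδ fun Ψ hΨ => ?_
    obtain ⟨c, hc, hcΨ⟩ := hnear Ψ hΨ
    have hcm : Measurable fun X => c * (groundState v (n + 1) L X : ℂ) :=
      measurable_const.mul hΨ₀m
    have hc1 : ∫⁻ X, (‖c * (groundState v (n + 1) L X : ℂ)‖₊ : ℝ≥0∞) ^ 2 = 1 := by
      have e : ∀ X, (‖c * (groundState v (n + 1) L X : ℂ)‖₊ : ℝ≥0∞) ^ 2 =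
          (‖(groundState v (n + 1) L X : ℂ)‖₊ : ℝ≥0∞) ^ 2 := fun X => by
        rw [nnnorm_mul, ENNReal.coe_mul, mul_pow, coe_nnnorm_eq_one_of_norm_eq_one hc, one_pow,
          one_mul]
      simp_rw [e, hΨ₀1]
    have h := SoloInformed.maxOccupation_rpow_half_le_add hcm Ψ.contDiff.continuous.measurable
      (by rw [hc1]; exact ENNReal.one_ne_top) (by rw [Ψ.norm_eq]; exact ENNReal.one_ne_top)
    rw [SoloInformed.maxOccupation_const_mul_of_norm_eq_one hc] at h
    have hdist : ∫⁻ X, (‖c * (groundState v (n + 1) L X : ℂ) - Ψ.ψ X‖₊ : ℝ≥0∞) ^ 2 ≤ ε := by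
      refine le_of_eq_of_le (lintegral_congr fun X => ?_) hcΨ
      rw [← nnnorm_neg, neg_sub]
    have hb : ((n + 1 : ℝ≥0∞) *
        ∫⁻ X, (‖c * (groundState v (n + 1) L X : ℂ) - Ψ.ψ X‖₊ : ℝ≥0∞) ^ 2) ^ (1 / 2 : ℝ) ≤
        ((n + 1 : ℝ≥0∞) * ε) ^ (1 / 2 : ℝ) :=
      ENNReal.rpow_le_rpow (mul_le_mul_right hdist _) hhalf
    have hsub : A ^ (1 / 2 : ℝ) - ((n + 1 : ℝ≥0∞) * ε) ^ (1 / 2 : ℝ) ≤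
        maxOccupation (n + 1) Ψ.ψ ^ (1 / 2 : ℝ) :=
      (tsub_le_tsub_left hb _).trans (tsub_le_iff_right.2 h)
    calc (A ^ (1 / 2 : ℝ) - ((n + 1 : ℝ≥0∞) * ε) ^ (1 / 2 : ℝ)) ^ 2
        ≤ (maxOccupation (n + 1) Ψ.ψ ^ (1 / 2 : ℝ)) ^ 2 := by gcongr
      _ = maxOccupation (n + 1) Ψ.ψ := ENNReal.rpow_half_sq _
  -- let `ε = 1/k → 0`
  have h1 : Tendsto (fun k : ℕ => (n + 1 : ℝ≥0∞) * (k : ℝ≥0∞)⁻¹) atTop (𝓝 0) := by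
    have := ENNReal.Tendsto.const_mul ENNReal.tendsto_inv_nat_nhds_zero (Or.inr hN)
    rwa [mul_zero] at this
  have h2 : Tendsto (fun k : ℕ => ((n + 1 : ℝ≥0∞) * (k : ℝ≥0∞)⁻¹) ^ (1 / 2 : ℝ)) atTop (𝓝 0) := by
    have := ((ENNReal.continuous_rpow_const (y := (1 / 2 : ℝ))).tendsto (0 : ℝ≥0∞)).comp h1
    rwa [ENNReal.zero_rpow_of_pos (by norm_num : (0 : ℝ) < 1 / 2)] at this
  have h3 : Tendsto (fun k : ℕ => A ^ (1 / 2 : ℝ) - ((n + 1 : ℝ≥0∞) * (k : ℝ≥0∞)⁻¹) ^ (1 / 2 : ℝ))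
      atTop (𝓝 (A ^ (1 / 2 : ℝ))) := by
    have := ENNReal.Tendsto.sub (tendsto_const_nhds (x := A ^ (1 / 2 : ℝ))) h2
      (Or.inl (ENNReal.rpow_ne_top_of_nonneg hhalf hAtop))
    rwa [tsub_zero] at this
  have h4 := ((ENNReal.continuous_pow 2).tendsto _).comp h3
  rw [ENNReal.rpow_half_sq] at h4
  exact le_of_tendsto h4 (Eventually.of_forall fun k =>
    key _ (ENNReal.inv_pos.2 (ENNReal.natCast_ne_top k)))

/-- **The condensate number of the conjunct is `λ_max` of the ground state's one-particle density
matrix** whenever the ground state is nondegenerate: `condensateNumber v N L = λ_max(γ_{Ψ₀})`,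
`Ψ₀ = groundState v N L` (the nonnegative normalised ground state). This is the faithfulness of
the audited statement's minimising-sequence definition. [cite: LSSY2005, §1.2 (1.17)–(1.19)] -/
theorem SoloInformed.condensateNumber_eq_maxOccupation_groundState {v : ℝ → ℝ≥0∞} {L : ℝ}
    (hL : 0 ≤ L) (hU : HasUniqueGroundState v (n + 1) L) :
    condensateNumber v (n + 1) L =
      maxOccupation (n + 1) (fun X => (groundState v (n + 1) L X : ℂ)) :=
  le_antisymm
    (SoloInformed.condensateNumber_le_maxOccupation_of_isGroundState hU.isGroundState_groundState)
    (SoloInformed.maxOccupation_groundState_le_condensateNumber hL hU)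

/-! ### The doors -/

/-- **Ground-state door (λ_max form).** If the ground states of the thermodynamic boxes
`Λ_{L_N}`, `L_N = (N/ρ)^{1/3}`, are eventually nondegenerate and their one-particle density
matrices have `λ_max(γ_{Ψ₀}) ≥ c N` for all large `N`, then `HasGroundStateBEC v ρ`.
[cite: LSSY2005, §1.2 (1.19)] -/
theorem SoloInformed.hasGroundStateBEC_of_groundState_maxOccupation (v : ℝ → ℝ≥0∞) {ρ : ℝ}
    (hρ : 0 < ρ) {c : ℝ} (hc : 0 < c)
    (hU : ∀ᶠ N : ℕ in atTop, HasUniqueGroundState v N (sideLength ρ N))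
    (hocc : ∀ᶠ N : ℕ in atTop, ENNReal.ofReal (c * N) ≤
      maxOccupation N (fun X => (groundState v N (sideLength ρ N) X : ℂ))) :
    HasGroundStateBEC v ρ := by
  refine ⟨c, hc, ?_⟩
  filter_upwards [hU, hocc, eventually_ge_atTop 1] with N hUN hoccN hN1
  obtain ⟨m, rfl⟩ : ∃ m, N = m + 1 := ⟨N - 1, (Nat.sub_add_cancel hN1).symm⟩
  rw [SoloInformed.condensateNumber_eq_maxOccupation_groundState
    (sideLength_nonneg hρ.le _) hUN]
  exact hoccN

/-- **Ground-state door (mode form).** If the ground states of the thermodynamic boxes are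
eventually nondegenerate and some normalised modes `φ_N` have `⟨φ_N, γ_{Ψ₀} φ_N⟩ ≥ c N` for all
large `N` (e.g. the flat mode `L_N^{-3/2} 1_{Λ_{L_N}}`), then `HasGroundStateBEC v ρ`.
[cite: LSSY2005, §1.2 (1.17)–(1.19)] -/
theorem SoloInformed.hasGroundStateBEC_of_groundState_occupation (v : ℝ → ℝ≥0∞) {ρ : ℝ}
    (hρ : 0 < ρ) {c : ℝ} (hc : 0 < c)
    (hU : ∀ᶠ N : ℕ in atTop, HasUniqueGroundState v N (sideLength ρ N))
    (φ : ℕ → Space → ℂ)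
    (hφ : ∀ N, AEStronglyMeasurable (φ N) volume ∧ ∫⁻ x, (‖φ N x‖₊ : ℝ≥0∞) ^ 2 = 1)
    (hocc : ∀ᶠ N : ℕ in atTop, ENNReal.ofReal (c * N) ≤
      occupation N (φ N) (fun X => (groundState v N (sideLength ρ N) X : ℂ))) :
    HasGroundStateBEC v ρ :=
  SoloInformed.hasGroundStateBEC_of_groundState_maxOccupation v hρ hc hU
    (hocc.mono fun N hN => hN.trans (occupation_le_maxOccupation _ (hφ N).1 (hφ N).2))

/-- **The conjunct through the ground-state door.** If for every repulsive finite-range `v`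
there is `ρ₀ > 0` such that at every density `ρ ∈ (0, ρ₀)` the ground states of the boxes
`Λ_{(N/ρ)^{1/3}}` are eventually nondegenerate with `λ_max(γ_{Ψ₀}) ≥ c(ρ) N`, then
`BoseEinsteinCondensation` holds. (Nondegeneracy is Reed–Simon IV Thm XIII.47 for finite `v`; the
`λ_max` bound uniformly in the volume is the open problem.) [cite: LSSY2005, §1.2 (1.19)] -/
theorem SoloInformed.boseEinsteinCondensation_of_groundState_maxOccupation
    (H : ∀ v : ℝ → ℝ≥0∞, IsRepulsiveFiniteRange v →
      ∃ ρ₀ : ℝ, 0 < ρ₀ ∧ ∀ ρ : ℝ, 0 < ρ → ρ < ρ₀ →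
        (∀ᶠ N : ℕ in atTop, HasUniqueGroundState v N (sideLength ρ N)) ∧
        ∃ c : ℝ, 0 < c ∧ ∀ᶠ N : ℕ in atTop, ENNReal.ofReal (c * N) ≤
          maxOccupation N (fun X => (groundState v N (sideLength ρ N) X : ℂ))) :
    _root_.BoseEinsteinCondensation := by
  intro v hv
  obtain ⟨ρ₀, hρ₀, hρ⟩ := H v hv
  refine ⟨ρ₀, hρ₀, fun ρ h0 h1 => ?_⟩
  obtain ⟨hU, c, hc, h⟩ := hρ ρ h0 h1
  exact SoloInformed.hasGroundStateBEC_of_groundState_maxOccupation v h0 hc hU h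

end Summit.AtomisticToContinuum.BoseEinsteinCondensation.Theorems

end
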